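import Literature.MathematicalPhysics.QuantumFieldTheory.Balaban1983to89.B8Prop5UniqKLevelB
import Literature.MathematicalPhysics.QuantumFieldTheory.Balaban1983to89.B8Prop5ContractionKLevelSrc

/-!
# `Balaban1983to89.B8Prop5UniqKLevelBSrc` — [Balaban1985RegularSpaces] Proposition 5's UNIQUENESS clause (1.109) p. 94 AT THEOREM 8's SOURCED GAUGE CONDITION
# (1.146) p. 101: `B8Prop5UniqKLevelB` (n04-b's converse-of-the-JOIN engine with the guarded left-inverse law) RE-RUN on the sourced contraction
# `B8Prop5ContractionKLevelSrc` (`W ↦ W − f`) — the engine behind the N05 knit's sourced socket `SP5u`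

statement-level skeleton of published theorems with citation tags; proofs where landed; nothing here is a claim about the Yang–Mills mass gap

T. Bałaban, *Spaces of regular gauge field configurations on a lattice and gauge fixing conditions*, Commun. Math. Phys. **99** (1985) 75–102
`[Balaban1985RegularSpaces]` ("B8"; journal page = PDF page + 74): Prop. 5 (1.109) p. 94, (1.93)–(1.100) pp. 92–93, (1.113)–(1.114) p. 95, (1.79) p. 90, Thm 8 (1.146) p. 101
(«there exists exactly one gauge transformation u …»); [4] = [Balaban1985BackgroundPropagators] Thm 3.1 p. 397, (3.25) p. 394.

## WHY THIS FILE (cell `pub-ymgap`, HUMAN RULING D-0062; R134 seat `pub-ymgap-dag-n05-d` g5, DAG node N05 = [B8]; count-neutral)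

Sixth brick of the sourced Proposition-5 providers (after the sourced engine, JOIN-A, JOIN, the datum's gradient bound and the socket assembly): the UNIQUENESS side.  The
un-sourced chain `B8Prop5UniqKLevelB` → `B8Prop5UniqSectEW` → `B8SockP5uEAssemblyB` ∕ `B8Prop5UniqueZdLan` turns two candidates obeying the multiplier form of (1.38) into
two fixed points of ONE contraction and concludes by its ∃!.  With Theorem 8's source the candidates obey the multiplier form of (1.146) (`… − f`) and are fixed points of
the SOURCED contraction `Ψ_f` (`B8Prop5ContractionKLevelSrc`), whose ∃! is `propFive_fixedPoint_kLevel_src`.  THIS FILE re-runs n04-b's ∕ this base's g3 engine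
accordingly: `isFixedPoint_of_cond146_bdd` (the multiplier form of (1.146) + (1.79) ⇒ fixed point of `Ψ_f`; the source only enlarges the boundedness certificate used by the
guarded left-inverse law) and ★ `hFP_unique_of_cond146_bdd` (two such candidates are equal).  NEXT (provider lineage): `B8Prop5UniqSectEW` ∕ `B8SockP5uEAssemblyB` twins on it
⇒ the `SP5u` face at the law members (after n05-c's ρ1∕ρ2 fix the socket's admissibility text).

HONEST SCOPE.  A re-run with one additive term; nothing of [4], of Sect. E or of the contraction is proved beyond the composition; the letters and windows are displayed
hypotheses.  Count-neutral; N05 NOT discharged; one finite `T⁴` programme at fixed `ε`, Bałaban as printed — nothing continuum ∕ ℝ⁴ ∕ OS ∕ mass-gap ∕ Clay.  No `sorry`,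
no definition.  Unit `pub-ymgap-dag-n05-d` (g5), 2026-08-27.

[cite: Balaban1985RegularSpaces, Prop. 5 (1.109) p.94, (1.93)–(1.100) pp.92–93, (1.79) p.90, (1.113)–(1.114) p.95, Thm 8 (1.146) p.101; Balaban1985BackgroundPropagators, Thm 3.1 p.397, (3.25) p.394]
-/

noncomputable section

open NormedSpace Metric Set Filter Topology
open Complex (I)

namespace Literature.MathematicalPhysics.QuantumFieldTheory.Balaban1983to89.B8Prop5UniqKLevelBSrc


open B7Prop1Explicit (e U1)
open B7Prop2Explicit (unitaryUnits unitaryUnits_le_U1)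
open B7Eq78Linearization (conjR)
open B7Eq167Flat (Cond167)
open B8Ineq132 (covDerivFwd covDeriv norm_conjR)
open B8Eq119TwistedAxial (Restr129)
open B8Eq138LandauZd (covLap covDivB QT covLap_zero)
open B8Eq178Averages (util178 Qnl Cond179 restr129_mul_iff_cond179)
open B8Eq182Proof (gAd)
open B8Eq184Proof (gaugeExp)
open B8Eq188Proof (frakF3 gAd_neg gAd_add)
open B8SectDSource (fixedPoint_closedBall)
open B8LambdaSpaceKLevel (wt wt_pos wt_nonneg lamSubK lamOf lamOf_sub norm_lamOf_le weight_mul_norm_covDerivFwd_le mkLam lamOf_mkLam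
  norm_mkLam_le norm_le_iff norm_sub_le_iff covDerivFwd_add' covDerivFwd_sub')
open B8Prop5ContractionKLevel (Bd2 Zsol Vop Wsrc PsiP5 Mc Kc mWc mWc_nonneg zsol_eq bd2_zsol Vop_sub norm_Vop_le
  wt_sq_norm_Wsrc_le)
open B8Prop5ContractionKLevelSrc (PsiP5src propFive_fixedPoint_kLevel_src mWc_add_half)
open B8Prop5UniqKLevelB (proj325_eq_zero_of_multiplier_guarded)
open B8Prop5GaugeParamKLevel (gpar_size gpar_grad gpar_lip norm_covDeriv_eq)
open B8Prop5KLevelLetters (dstar_rhs_eq_W_add covLap_sub)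
open B8Restr129Inversion (restr129_mul_iff_inv_mul)
open B8Eq195Linear (proj325_sub)
open B8Prop5JoinHFP (covLap_neg')
open B8Prop5UniqKLevel (sectE_inverse_kLevel bd2_covLap_lamOf neumann_injective)

-- `Site` alone could resolve to the torus sites of `Setup.lean`; re-export the `ℤ^d` sites of `B7Prop1Explicit`.
export B7Prop1Explicit (Site)

variable {d : ℕ} {𝔸 : Type*} [CStarAlgebra 𝔸] [Nontrivial 𝔸]

/-! ## The converse of the sourced JOIN and Proposition 5's uniqueness clause at the sourced gauge condition -/

section Converse146B

variable {L k : ℕ} {η : ℝ} {Ω Λs : ℕ → Set (Site d)} {Eb : ℕ → Set (Site d × Fin d)} {U₀ : Site d → Fin d → 𝔸ˣ}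
  {A : Site d → Fin d → 𝔸} {u₁ : Site d → 𝔸ˣ}
/-- **THE CONVERSE OF THE SOURCED JOIN, ROUTE-AGNOSTIC, LEFT-INVERSE LAW OF `G′` ON BOUNDED FUNCTIONS** — `B8Prop5UniqKLevelB.isFixedPoint_of_cond179_bdd`
VERBATIM for Theorem 8's gauge condition (1.146): a candidate `λ′` in the ball whose gauge-fixed field obeys THE MULTIPLIER FORM OF (1.146) —
`Δ↾Ω₀[D*A + Δλ′ + 𝔑(λ′) − f] = Q′ᵀμ` — and (1.79) for its inverse pair IS `λ_t + H_cλ_t` for a fixed point `t` of the SOURCED contraction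
`λ_t = G′(Ψ_f λ_t)` (`B8Prop5ContractionKLevelSrc.PsiP5src`: `W ↦ W − f`).  The source `f` is a fixed function with finite `|f|₍₋₂₎` (it only enlarges the
boundedness certificate of the D*-identity's right-hand side); nothing else changes: inverse change of variables, `Q′λ_t = 0` from (1.114), `R N = 0` from the
multiplier clause at `N = (W − f) + Δλ_t + VΔλ_t` (n04-b's `dstar_rhs_eq_W_add`, source subtracted on both sides), Neumann injectivity, `λ_t = G′R(−Z′)`.
[cite: Balaban1985RegularSpaces, Prop. 5 (1.107)–(1.109) p.94, (1.93)–(1.100) pp.92–93, (1.79) p.90, (1.113)–(1.114) p.95, Thm 8 (1.146) p.101; Balaban1985BackgroundPropagators, Thm 3.1 p.397, (3.25) p.394] -/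
theorem isFixedPoint_of_cond146_bdd (hL : 1 ≤ L) (hη : 0 < η) (hU₀ : ∀ x κ, U₀ x κ ∈ unitaryUnits 𝔸) (hΩ0 : Ω 0 = Set.univ)
    (hEbΩ : ∀ j, j ≤ k → ∀ x ∈ Ω j, ∀ μ : Fin d, (x, μ) ∈ Eb j ∧ (x - e μ, μ) ∈ Eb j)
    -- letters of [4]
    (g Δ : (Site d → 𝔸) →ₗ[ℂ] (Site d → 𝔸)) (q : (Site d → 𝔸) →ₗ[ℂ] (ℕ → Site d → 𝔸)) (qs : (ℕ → Site d → 𝔸) →ₗ[ℂ] (Site d → 𝔸))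
    (Aw c : (ℕ → Site d → 𝔸) →ₗ[ℂ] (ℕ → Site d → 𝔸))
    (g_leftB : ∀ x : Site d → 𝔸, (∃ C : ℝ, ∀ y, ‖x y‖ ≤ C) → g (Δ x + qs (Aw (q x))) = x)
    (c_left' : ∀ φ, qs (c (q (g (g (qs φ))))) = qs φ)
    (hΔ : ∀ (f : Site d → 𝔸), ∀ x ∈ Ω 0, Δ f x = covLap η U₀ ((Ω 0).indicator f) x)
    (hqs : ∀ (μ : ℕ → Site d → 𝔸), ∀ x ∈ Ω 0, qs μ x = QT L k Λs U₀ μ x)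
    -- the Sect. E correction `H_c` (λ′ = λ + H_c λ) and the windows
    (Hc : (Site d → 𝔸) → (Site d → 𝔸))
    {α₄ BR h₀ h₁ h₂ l₀ l₁ cA cDA ρ : ℝ}
    (hBR : 0 ≤ BR) (hh₀ : 0 ≤ h₀) (hh₂ : 0 ≤ h₂) (hcA : 0 ≤ cA) (hcA' : cA ≤ 1 / 13) (hcDA : 0 ≤ cDA)
    (ha₁' : α₄ / 4 + h₀ ≤ 1 / 24) (hb₁' : α₄ / 4 + h₁ ≤ 1 / 140) (hb₁ : 0 < α₄ / 4 + h₁) (hθ : 10 * (α₄ / 4 + h₀) * BR ≤ 1 / 2)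
    (hl₀' : l₀ ≤ 1 / 2) (hl₁' : l₁ ≤ 1 / 2) (hρ₀ : ρ + h₀ ≤ α₄ / 4) (hρ₁ : ρ + h₁ ≤ α₄ / 4)
    -- (1.98)R
    (hRbd : ∀ (f : Site d → 𝔸) (m : ℝ), 0 ≤ m → Bd2 L η k Ω f m → Bd2 L η k Ω (f - g (qs (c (q (g f))))) (BR * m))
    -- the binders of `H_c`
    (hc0 : ∀ s : lamSubK η U₀ L k Eb, ‖s‖ ≤ α₄ / 4 → ∀ x, ‖Hc (lamOf s) x‖ ≤ h₀)
    (hc1 : ∀ s : lamSubK η U₀ L k Eb, ‖s‖ ≤ α₄ / 4 → ∀ j, j ≤ k → ∀ p ∈ Eb j, wt L η j * ‖covDerivFwd η U₀ p.2 (Hc (lamOf s)) p.1‖ ≤ h₁)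
    (hc2 : ∀ s : lamSubK η U₀ L k Eb, ‖s‖ ≤ α₄ / 4 → Bd2 L η k Ω (covLap η U₀ (Hc (lamOf s))) h₂)
    (hcL0 : ∀ s t : lamSubK η U₀ L k Eb, ‖s‖ ≤ α₄ / 4 → ‖t‖ ≤ α₄ / 4 → ∀ x, ‖Hc (lamOf s) x - Hc (lamOf t) x‖ ≤ l₀ * ‖s - t‖)
    (hcL1 : ∀ s t : lamSubK η U₀ L k Eb, ‖s‖ ≤ α₄ / 4 → ‖t‖ ≤ α₄ / 4 → ∀ j, j ≤ k → ∀ p ∈ Eb j,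
      wt L η j * ‖covDerivFwd η U₀ p.2 (Hc (lamOf s) - Hc (lamOf t)) p.1‖ ≤ l₁ * ‖s - t‖)
    -- the datum and THE SOURCE `f` (finite `|f|₍₋₂₎` on the `Ω_j`)
    (hDA : Bd2 L η k Ω (fun y => covDivB η U₀ A y) cDA) {f : Site d → 𝔸} {mf : ℝ} (hmf : 0 ≤ mf) (hf : Bd2 L η k Ω f mf)
    (hA : ∀ j, j ≤ k → ∀ x ∈ Ω j, ∀ μ : Fin d,
      wt L η j * ‖A x μ‖ ≤ cA ∧ wt L η j * ‖conjR (U₀ (x - e μ) μ)⁻¹ (A (x - e μ) μ)‖ ≤ cA)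
    -- Sect. E (1.114) in its converse printed use
    (h114q : ∀ s : lamSubK η U₀ L k Eb, ‖s‖ ≤ α₄ / 4 →
      Cond179 L k Λs U₀ (gaugeExp (lamOf s + Hc (lamOf s)))⁻¹ u₁⁻¹ → q (lamOf s) = 0)
    -- the candidate solution
    {lam : Site d → 𝔸} (hlρ : ∀ x, ‖lam x‖ ≤ ρ)
    (hDρ : ∀ j, j ≤ k → ∀ p ∈ Eb j, wt L η j * ‖covDerivFwd η U₀ p.2 lam p.1‖ ≤ ρ)
    (hmult : ∃ μ : ℕ → Site d → 𝔸, ∀ x ∈ Ω 0,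
      covLap η U₀ ((Ω 0).indicator fun y => covDivB η U₀ A y + covLap η U₀ lam y +
        ((conjR (gaugeExp lam y)⁻¹ (covDivB η U₀ A y) - covDivB η U₀ A y) +
          (gAd (covLap η U₀ lam y) (lam y) - covLap η U₀ lam y) + ∑ μ, frakF3 η U₀ lam A y μ) - f y) x = QT L k Λs U₀ μ x)
    (h179 : Cond179 L k Λs U₀ (gaugeExp lam)⁻¹ u₁⁻¹) :
    ∃ t : lamSubK η U₀ L k Eb, ‖t‖ ≤ α₄ / 4 ∧ lamOf t + Hc (lamOf t) = lam ∧
      lamOf t = g (PsiP5src η U₀ A (fun y => covDivB η U₀ A y) f (fun f => f - g (qs (c (q (g f)))))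
        (fun l => l + Hc l) (fun l => covLap η U₀ (Hc l)) (lamOf t)) := by
  have huniv : ∀ x, x ∈ Ω 0 := fun x => by rw [hΩ0]; exact Set.mem_univ x
  -- the letter R of (1.95)
  set R : (Site d → 𝔸) → (Site d → 𝔸) := fun f => f - g (qs (c (q (g f)))) with hRdef
  have hR : ∀ f, R f = f - g (qs (c (q (g f)))) := fun f => rfl
  have hRsub : ∀ f f' : Site d → 𝔸, R (f - f') = R f - R f' := proj325_sub (R := R) hR
  have hR0 : R 0 = 0 := by rw [hR]; simp
  have hRneg : ∀ f : Site d → 𝔸, R (-f) = -R f := fun f => by rw [← zero_sub, hRsub, hR0, zero_sub]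
  have hRadd : ∀ f f' : Site d → 𝔸, R (f + f') = R f + R f' := fun f f' => by
    have h := hRsub (f + f') f'
    rw [add_sub_cancel_right] at h
    rw [h, sub_add_cancel]
  -- Step 1: the inverse change of variables
  obtain ⟨t, ht, hgp⟩ := sectE_inverse_kLevel hη Hc hh₀ hl₀' hl₁' hρ₀ hρ₁ hc0 hc1 hcL0 hcL1 hlρ hDρ
  -- sizes of λ′ = λ_t + H_cλ_t
  have hρ0 : 0 ≤ ρ := (norm_nonneg _).trans (hlρ 0)
  have ha12 : ∀ x, ‖lam x‖ ≤ 1 / 12 := fun x => (hlρ x).trans (by linarith)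
  have hlam_a : ∀ x, ‖lam x‖ ≤ α₄ / 4 + h₀ := fun x => by rw [← hgp]; exact gpar_size hc0 t ht x
  have ha12' : α₄ / 4 + h₀ ≤ 1 / 12 := by linarith
  have hgrad : ∀ j, j ≤ k → ∀ x ∈ Ω j, ∀ μ : Fin d,
      wt L η j * ‖covDerivFwd η U₀ μ lam x‖ ≤ α₄ / 4 + h₁ ∧ wt L η j * ‖covDeriv η U₀ μ lam x‖ ≤ α₄ / 4 + h₁ := by
    intro j hj x hx μ
    rw [← hgp]
    exact gpar_grad hη hU₀ hEbΩ hc1 t ht hj hx μ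
  -- the Neumann data at λ′
  have hVsub : ∀ f f' : Site d → 𝔸, ∀ j, j ≤ k → ∀ x ∈ Ω j, Vop lam f x - Vop lam f' x = Vop lam (f - f') x :=
    fun f f' j _ x _ => Vop_sub f f' (ha12 x)
  have hVbd : ∀ f : Site d → 𝔸, ∀ j, j ≤ k → ∀ x ∈ Ω j, ‖Vop lam f x‖ ≤ 10 * (α₄ / 4 + h₀) * ‖f x‖ :=
    fun f j _ x _ => norm_Vop_le f (hlam_a x) ha12'
  have hcV : 0 ≤ 10 * (α₄ / 4 + h₀) := by linarith
  set mW := mWc d (α₄ / 4 + h₁) cA (h₂ + mf / 2) cDA with hmWdef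
  have hmW : 0 ≤ mW := mWc_nonneg hb₁.le hcA (by positivity) hcDA
  set W0 : Site d → 𝔸 := Wsrc η U₀ A (fun y => covDivB η U₀ A y) lam (covLap η U₀ (Hc (lamOf t))) with hW0def
  have hW0 : Bd2 L η k Ω W0 (mWc d (α₄ / 4 + h₁) cA h₂ cDA) := fun j hj x hx =>
    wt_sq_norm_Wsrc_le hL hη (by linarith : α₄ / 4 + h₁ ≤ 1 / 70) hcA (by linarith : cA ≤ 1 / 12) (ha12 x) (hgrad j hj x hx)
      (hA j hj x hx) (hc2 t ht j hj x hx) (hDA j hj x hx)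
  -- THE SOURCED NEUMANN DATUM `W₀ − f`
  set W : Site d → 𝔸 := W0 - f with hWdef
  have hW : Bd2 L η k Ω W mW := by rw [hmWdef, ← mWc_add_half]; exact hW0.sub hf
  set Z : Site d → 𝔸 := Zsol W (Vop lam) R with hZdef
  have hZeq : ∀ j, j ≤ k → ∀ x ∈ Ω j, Z x + Vop lam (R Z) x = W x :=
    fun j hj x hx => zsol_eq hL hη hVsub hVbd hRsub hRbd hW hcV hBR hmW hθ hj hx
  have hZbd : Bd2 L η k Ω Z (2 * mW) := bd2_zsol hL hη hVsub hVbd hRsub hRbd hW hcV hBR hmW hθ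
  -- Step 2: `Q′λ_t = 0` from (1.79) for the inverse pair and (1.114)
  have hq0 : q (lamOf t) = 0 := h114q t ht (by rw [hgp]; exact h179)
  -- Step 3: `R N = 0` for the right-hand side `N` of the D*-identity, from the multiplier clause
  set N : Site d → 𝔸 := fun y => covDivB η U₀ A y + covLap η U₀ lam y +
    ((conjR (gaugeExp lam y)⁻¹ (covDivB η U₀ A y) - covDivB η U₀ A y) +
      (gAd (covLap η U₀ lam y) (lam y) - covLap η U₀ lam y) + ∑ μ, frakF3 η U₀ lam A y μ) - f y with hNdef
  obtain ⟨μ, hμ⟩ := hmult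
  have hΔN : Δ N = qs μ := funext fun x => by
    rw [hΔ N x (huniv x), hqs μ x (huniv x)]
    exact hμ x (huniv x)
  -- Step 4: `N = W + (Δλ_t + V Δλ_t)` (the D*-identity's right-hand side regrouped at λ′ = λ_t − (−H_cλ_t))
  set Y : Site d → 𝔸 := covLap η U₀ (lamOf t) with hYdef
  have hdef : lam = lamOf t - (-Hc (lamOf t)) := by rw [sub_neg_eq_add, hgp]
  have hNW : N = W + (Y + Vop lam Y) := funext fun y => by
    have h := dstar_rhs_eq_W_add (η := η) U₀ A hdef (ha12 y)
    rw [covLap_neg', gAd_neg _ (ha12 y), sub_neg_eq_add] at h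
    -- `h` : the un-sourced right-hand side at `y` equals `W₀ y + (Y y + V Y y)`; subtract the source on both sides
    have h0 : N y + f y = (W0 + (Y + Vop lam Y)) y := by
      simp only [hNdef, sub_add_cancel]
      exact h
    show N y = ((W0 - f) + (Y + Vop lam Y)) y
    rw [eq_sub_of_add_eq h0]
    simp only [Pi.add_apply, Pi.sub_apply]
    abel
  -- (W8″ guard) `N` is a BOUNDED function: `Bd2`-bounded through `W`, `Δλ_t`, `VΔλ_t`, hence sup-bounded as `Ω 0 = univ`
  have hNbd2 : Bd2 L η k Ω N (mW + (2 * d * (L : ℝ) ^ k * ‖t‖ + 10 * (α₄ / 4 + h₀) * (2 * d * (L : ℝ) ^ k * ‖t‖))) := by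
    have hY : Bd2 L η k Ω Y (2 * d * (L : ℝ) ^ k * ‖t‖) := bd2_covLap_lamOf hL hη hU₀ hEbΩ t
    have hVY : Bd2 L η k Ω (Vop lam Y) (10 * (α₄ / 4 + h₀) * (2 * d * (L : ℝ) ^ k * ‖t‖)) := fun j hj x hx => by
      calc wt L η j ^ 2 * ‖Vop lam Y x‖ ≤ wt L η j ^ 2 * (10 * (α₄ / 4 + h₀) * ‖Y x‖) :=
            mul_le_mul_of_nonneg_left (hVbd Y j hj x hx) (sq_nonneg _)
        _ = 10 * (α₄ / 4 + h₀) * (wt L η j ^ 2 * ‖Y x‖) := by ring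
        _ ≤ 10 * (α₄ / 4 + h₀) * (2 * d * (L : ℝ) ^ k * ‖t‖) := mul_le_mul_of_nonneg_left (hY j hj x hx) hcV
    rw [hNW]
    exact hW.add (hY.add hVY)
  have hNbdd : ∃ C : ℝ, ∀ y, ‖N y‖ ≤ C :=
    ⟨_, fun y => hNbd2.norm_le hL hη (Nat.zero_le _) (huniv y)⟩
  have hRN : R N = 0 :=
    proj325_eq_zero_of_multiplier_guarded g Δ q qs Aw c (P := fun x : Site d → 𝔸 => ∃ C : ℝ, ∀ y, ‖x y‖ ≤ C) g_leftB c_left' hNbdd hΔN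
  -- Step 5: `RΔλ_t = Δλ_t`, and the Neumann identity, give `Δλ_t = −RZ`
  have hYΔ : Y = Δ (lamOf t) := funext fun x => by
    rw [hΔ _ x (huniv x), hΩ0, Set.indicator_univ]
  have hgY : g Y = lamOf t := by
    have h := g_leftB (lamOf t) ⟨‖t‖, norm_lamOf_le t⟩
    rw [hq0, map_zero, map_zero, add_zero, ← hYΔ] at h
    exact h
  have hRY : R Y = Y := by
    rw [hR, hgY, hq0, map_zero, map_zero, map_zero, sub_zero]
  have hVadd : ∀ f f' : Site d → 𝔸, Vop lam (f + f') = Vop lam f + Vop lam f' := fun f f' => by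
    funext x
    have h := Vop_sub (a := lam) (f + f') f' (ha12 x)
    rw [add_sub_cancel_right] at h
    rw [Pi.add_apply, ← h, sub_add_cancel]
  have hWfun : W = Z + Vop lam (R Z) := funext fun x => by
    rw [Pi.add_apply]
    exact (hZeq 0 (Nat.zero_le _) x (huniv x)).symm
  set D : Site d → 𝔸 := Y + R Z with hDdef
  have hDeq : D = -R (Vop lam D) := by
    have h1 : R Z + R (Vop lam (R Z)) + (Y + R (Vop lam Y)) = 0 := by
      calc R Z + R (Vop lam (R Z)) + (Y + R (Vop lam Y)) = R N := by rw [hNW, hRadd, hRadd, hWfun, hRadd, hRY]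
        _ = 0 := hRN
    have h2 : R (Vop lam D) = R (Vop lam Y) + R (Vop lam (R Z)) := by rw [hDdef, hVadd, hRadd]
    have h3 : (Y + R Z) + (R (Vop lam Y) + R (Vop lam (R Z))) = 0 := by rw [← h1]; abel
    rw [h2]
    exact eq_neg_of_add_eq_zero_left h3
  have hDbd : Bd2 L η k Ω D (2 * d * (L : ℝ) ^ k * ‖t‖ + BR * (2 * mW)) :=
    (bd2_covLap_lamOf hL hη hU₀ hEbΩ t).add (hRbd Z (2 * mW) (by positivity) hZbd)
  have hD0 : ∀ j, j ≤ k → ∀ x ∈ Ω j, D x = 0 :=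
    neumann_injective hL hη hVbd hRbd hcV (by positivity) hθ hDbd fun j _ x _ => congrFun hDeq x
  have hYRZ : Y = -R Z := funext fun x => by
    have h : Y x + R Z x = 0 := hD0 0 (Nat.zero_le _) x (huniv x)
    rw [Pi.neg_apply]
    exact eq_neg_of_add_eq_zero_left h
  -- Step 6: the fixed-point equation (1.100): `λ_t = G′Δλ_t = G′R(−Z)`
  have hΔt : Δ (lamOf t) = R (fun x => -Z x) := by
    rw [← hYΔ, hYRZ, ← hRneg]
    rfl
  have hfix : lamOf t = g (R (fun x => -Z x)) := by
    have h := g_leftB (lamOf t) ⟨‖t‖, norm_lamOf_le t⟩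
    rw [hq0, map_zero, map_zero, add_zero, hΔt] at h
    exact h.symm
  refine ⟨t, ht, hgp, ?_⟩
  simp only [PsiP5src, hgp]
  exact hfix

/-- ★ **PROPOSITION 5's UNIQUENESS CLAUSE (1.109) AT THE SOURCED GAUGE CONDITION (Theorem 8), AT `k` LEVELS, ROUTE-AGNOSTIC** —
`B8Prop5UniqKLevelB.hFP_unique_of_cond179_bdd` VERBATIM with the multiplier clauses of the two candidates carrying the source (`… − f`) and the ∃! taken from
`B8Prop5ContractionKLevelSrc.propFive_fixedPoint_kLevel_src` (windows at `h₂ + m_f∕2`): two site functions `λ′₁, λ′₂`, each with `‖λ′ᵢ‖ ≤ ρ`, `(Lʲη)‖D λ′ᵢ‖ ≤ ρ` on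
the `Eb j`, each obeying the sourced multiplier clause and (1.79) for its inverse pair, ARE EQUAL.  The engine behind the N05 knit's sourced socket `SP5u`.
[cite: Balaban1985RegularSpaces, Prop. 5 (1.109) p.94, (1.100) p.93, Thm 8 (1.146) p.101 («exactly one gauge transformation u»); Balaban1985BackgroundPropagators, Thm 3.1 p.397] -/
theorem hFP_unique_of_cond146_bdd (hL : 1 ≤ L) (hη : 0 < η) (hU₀ : ∀ x κ, U₀ x κ ∈ unitaryUnits 𝔸) (hΩ0 : Ω 0 = Set.univ)
    (hEbΩ : ∀ j, j ≤ k → ∀ x ∈ Ω j, ∀ μ : Fin d, (x, μ) ∈ Eb j ∧ (x - e μ, μ) ∈ Eb j)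
    -- letters of [4]
    (g Δ : (Site d → 𝔸) →ₗ[ℂ] (Site d → 𝔸)) (q : (Site d → 𝔸) →ₗ[ℂ] (ℕ → Site d → 𝔸)) (qs : (ℕ → Site d → 𝔸) →ₗ[ℂ] (Site d → 𝔸))
    (Aw c : (ℕ → Site d → 𝔸) →ₗ[ℂ] (ℕ → Site d → 𝔸))
    (g_leftB : ∀ x : Site d → 𝔸, (∃ C : ℝ, ∀ y, ‖x y‖ ≤ C) → g (Δ x + qs (Aw (q x))) = x)
    (c_left' : ∀ φ, qs (c (q (g (g (qs φ))))) = qs φ)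
    (hΔ : ∀ (f : Site d → 𝔸), ∀ x ∈ Ω 0, Δ f x = covLap η U₀ ((Ω 0).indicator f) x)
    (hqs : ∀ (μ : ℕ → Site d → 𝔸), ∀ x ∈ Ω 0, qs μ x = QT L k Λs U₀ μ x)
    -- the Sect. E correction `H_c` (λ′ = λ + H_c λ) and the windows
    (Hc : (Site d → 𝔸) → (Site d → 𝔸))
    {α₄ BG BR h₀ h₁ h₂ l₀ l₁ l₂ cA cDA ρ : ℝ}
    (hα₄ : 0 ≤ α₄) (hBG : 0 ≤ BG) (hBR : 0 ≤ BR) (hh₀ : 0 ≤ h₀) (hh₂ : 0 ≤ h₂) (hl₀ : 0 ≤ l₀) (hl₁ : 0 ≤ l₁) (hl₂ : 0 ≤ l₂)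
    (hcA : 0 ≤ cA) (hcA' : cA ≤ 1 / 13) (hcDA : 0 ≤ cDA)
    (ha₁' : α₄ / 4 + h₀ ≤ 1 / 24) (hb₁' : α₄ / 4 + h₁ ≤ 1 / 140) (hb₁ : 0 < α₄ / 4 + h₁) (hθ : 10 * (α₄ / 4 + h₀) * BR ≤ 1 / 2)
    (hl₀' : l₀ ≤ 1 / 2) (hl₁' : l₁ ≤ 1 / 2) (hρ₀ : ρ + h₀ ≤ α₄ / 4) (hρ₁ : ρ + h₁ ≤ α₄ / 4)
    -- (1.101) for G′, (1.98)R
    (hG : ∀ (f : Site d → 𝔸) (m : ℝ), 0 ≤ m → Bd2 L η k Ω f m →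
      (∀ x, ‖g f x‖ ≤ BG * m) ∧ ∀ j, j ≤ k → ∀ p ∈ Eb j, wt L η j * ‖covDerivFwd η U₀ p.2 (g f) p.1‖ ≤ BG * m)
    (hRbd : ∀ (f : Site d → 𝔸) (m : ℝ), 0 ≤ m → Bd2 L η k Ω f m → Bd2 L η k Ω (f - g (qs (c (q (g f))))) (BR * m))
    -- the binders of `H_c`
    (hc0 : ∀ s : lamSubK η U₀ L k Eb, ‖s‖ ≤ α₄ / 4 → ∀ x, ‖Hc (lamOf s) x‖ ≤ h₀)
    (hc1 : ∀ s : lamSubK η U₀ L k Eb, ‖s‖ ≤ α₄ / 4 → ∀ j, j ≤ k → ∀ p ∈ Eb j, wt L η j * ‖covDerivFwd η U₀ p.2 (Hc (lamOf s)) p.1‖ ≤ h₁)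
    (hc2 : ∀ s : lamSubK η U₀ L k Eb, ‖s‖ ≤ α₄ / 4 → Bd2 L η k Ω (covLap η U₀ (Hc (lamOf s))) h₂)
    (hcL0 : ∀ s t : lamSubK η U₀ L k Eb, ‖s‖ ≤ α₄ / 4 → ‖t‖ ≤ α₄ / 4 → ∀ x, ‖Hc (lamOf s) x - Hc (lamOf t) x‖ ≤ l₀ * ‖s - t‖)
    (hcL1 : ∀ s t : lamSubK η U₀ L k Eb, ‖s‖ ≤ α₄ / 4 → ‖t‖ ≤ α₄ / 4 → ∀ j, j ≤ k → ∀ p ∈ Eb j,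
      wt L η j * ‖covDerivFwd η U₀ p.2 (Hc (lamOf s) - Hc (lamOf t)) p.1‖ ≤ l₁ * ‖s - t‖)
    (hcL2 : ∀ s t : lamSubK η U₀ L k Eb, ‖s‖ ≤ α₄ / 4 → ‖t‖ ≤ α₄ / 4 →
      Bd2 L η k Ω (covLap η U₀ (Hc (lamOf s)) - covLap η U₀ (Hc (lamOf t))) (l₂ * ‖s - t‖))
    -- the datum and THE SOURCE `f`
    (hDA : Bd2 L η k Ω (fun y => covDivB η U₀ A y) cDA) {f : Site d → 𝔸} {mf : ℝ} (hmf : 0 ≤ mf) (hf : Bd2 L η k Ω f mf)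
    (hA : ∀ j, j ≤ k → ∀ x ∈ Ω j, ∀ μ : Fin d,
      wt L η j * ‖A x μ‖ ≤ cA ∧ wt L η j * ‖conjR (U₀ (x - e μ) μ)⁻¹ (A (x - e μ) μ)‖ ≤ cA)
    -- smallness (1.103)/(1.106)
    (h103 : BG * Mc d BR (α₄ / 4 + h₁) cA (h₂ + mf / 2) cDA ≤ α₄ / 4)
    (h106 : BG * Kc d BR (α₄ / 4 + h₁) cA (h₂ + mf / 2) cDA l₂ (1 + l₀) (1 + l₁) ≤ 1 / 2)
    -- Sect. E (1.114) in its converse printed use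
    (h114q : ∀ s : lamSubK η U₀ L k Eb, ‖s‖ ≤ α₄ / 4 →
      Cond179 L k Λs U₀ (gaugeExp (lamOf s + Hc (lamOf s)))⁻¹ u₁⁻¹ → q (lamOf s) = 0)
    -- the two solutions
    {lam₁ lam₂ : Site d → 𝔸}
    (hl₁ : ∀ x, ‖lam₁ x‖ ≤ ρ) (hD₁ : ∀ j, j ≤ k → ∀ p ∈ Eb j, wt L η j * ‖covDerivFwd η U₀ p.2 lam₁ p.1‖ ≤ ρ)
    (hmult₁ : ∃ μ : ℕ → Site d → 𝔸, ∀ x ∈ Ω 0,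
      covLap η U₀ ((Ω 0).indicator fun y => covDivB η U₀ A y + covLap η U₀ lam₁ y +
        ((conjR (gaugeExp lam₁ y)⁻¹ (covDivB η U₀ A y) - covDivB η U₀ A y) +
          (gAd (covLap η U₀ lam₁ y) (lam₁ y) - covLap η U₀ lam₁ y) + ∑ μ, frakF3 η U₀ lam₁ A y μ) - f y) x = QT L k Λs U₀ μ x)
    (h179₁ : Cond179 L k Λs U₀ (gaugeExp lam₁)⁻¹ u₁⁻¹)
    (hl₂' : ∀ x, ‖lam₂ x‖ ≤ ρ) (hD₂ : ∀ j, j ≤ k → ∀ p ∈ Eb j, wt L η j * ‖covDerivFwd η U₀ p.2 lam₂ p.1‖ ≤ ρ)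
    (hmult₂ : ∃ μ : ℕ → Site d → 𝔸, ∀ x ∈ Ω 0,
      covLap η U₀ ((Ω 0).indicator fun y => covDivB η U₀ A y + covLap η U₀ lam₂ y +
        ((conjR (gaugeExp lam₂ y)⁻¹ (covDivB η U₀ A y) - covDivB η U₀ A y) +
          (gAd (covLap η U₀ lam₂ y) (lam₂ y) - covLap η U₀ lam₂ y) + ∑ μ, frakF3 η U₀ lam₂ A y μ) - f y) x = QT L k Λs U₀ μ x)
    (h179₂ : Cond179 L k Λs U₀ (gaugeExp lam₂)⁻¹ u₁⁻¹) :
    lam₁ = lam₂ := by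
  obtain ⟨t₁, ht₁, hgp₁, hfix₁⟩ := isFixedPoint_of_cond146_bdd hL hη hU₀ hΩ0 hEbΩ g Δ q qs Aw c g_leftB c_left' hΔ hqs Hc hBR hh₀ hh₂ hcA
    hcA' hcDA ha₁' hb₁' hb₁ hθ hl₀' hl₁' hρ₀ hρ₁ hRbd hc0 hc1 hc2 hcL0 hcL1 hDA hmf hf hA h114q hl₁ hD₁ hmult₁ h179₁
  obtain ⟨t₂, ht₂, hgp₂, hfix₂⟩ := isFixedPoint_of_cond146_bdd hL hη hU₀ hΩ0 hEbΩ g Δ q qs Aw c g_leftB c_left' hΔ hqs Hc hBR hh₀ hh₂ hcA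
    hcA' hcDA ha₁' hb₁' hb₁ hθ hl₀' hl₁' hρ₀ hρ₁ hRbd hc0 hc1 hc2 hcL0 hcL1 hDA hmf hf hA h114q hl₂' hD₂ hmult₂ h179₂
  -- the letter R and the displayed maps of the contraction
  set R : (Site d → 𝔸) → (Site d → 𝔸) := fun f => f - g (qs (c (q (g f)))) with hRdef
  have hR : ∀ f, R f = f - g (qs (c (q (g f)))) := fun f => rfl
  have hRsub : ∀ f f' : Site d → 𝔸, R (f - f') = R f - R f' := proj325_sub (R := R) hR
  set gpar : (Site d → 𝔸) → (Site d → 𝔸) := fun lam => lam + Hc lam with hgpar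
  set Eterm : (Site d → 𝔸) → (Site d → 𝔸) := fun lam => covLap η U₀ (Hc lam) with hEterm
  have hg0 : ∀ s : lamSubK η U₀ L k Eb, ‖s‖ ≤ α₄ / 4 → ∀ j, j ≤ k → ∀ x ∈ Ω j, ‖gpar (lamOf s) x‖ ≤ α₄ / 4 + h₀ :=
    fun s hs j _ x _ => gpar_size hc0 s hs x
  have hg1 : ∀ s : lamSubK η U₀ L k Eb, ‖s‖ ≤ α₄ / 4 → ∀ j, j ≤ k → ∀ x ∈ Ω j, ∀ μ : Fin d,
      wt L η j * ‖covDerivFwd η U₀ μ (gpar (lamOf s)) x‖ ≤ α₄ / 4 + h₁ ∧ wt L η j * ‖covDeriv η U₀ μ (gpar (lamOf s)) x‖ ≤ α₄ / 4 + h₁ :=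
    fun s hs j hj x hx μ => gpar_grad hη hU₀ hEbΩ hc1 s hs hj hx μ
  have hgL : ∀ s t : lamSubK η U₀ L k Eb, ‖s‖ ≤ α₄ / 4 → ‖t‖ ≤ α₄ / 4 → ∀ j, j ≤ k → ∀ x ∈ Ω j,
      ‖gpar (lamOf s) x - gpar (lamOf t) x‖ ≤ (1 + l₀) * ‖s - t‖ ∧ ∀ μ : Fin d,
        wt L η j * ‖covDerivFwd η U₀ μ (gpar (lamOf s) - gpar (lamOf t)) x‖ ≤ (1 + l₁) * ‖s - t‖ ∧
        wt L η j * ‖covDeriv η U₀ μ (gpar (lamOf s) - gpar (lamOf t)) x‖ ≤ (1 + l₁) * ‖s - t‖ :=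
    fun s t hs ht j hj x hx => gpar_lip hη hU₀ hEbΩ hcL0 hcL1 s t hs ht hj hx
  have hE0 : ∀ s : lamSubK η U₀ L k Eb, ‖s‖ ≤ α₄ / 4 → Bd2 L η k Ω (Eterm (lamOf s)) h₂ := fun s hs => hc2 s hs
  have hEL : ∀ s t : lamSubK η U₀ L k Eb, ‖s‖ ≤ α₄ / 4 → ‖t‖ ≤ α₄ / 4 →
      Bd2 L η k Ω (Eterm (lamOf s) - Eterm (lamOf t)) (l₂ * ‖s - t‖) := fun s t hs ht => hcL2 s t hs ht
  -- the ∃! of the contraction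
  obtain ⟨s, -, huniq⟩ := propFive_fixedPoint_kLevel_src (Ω := Ω) (Eb := Eb) (U₀ := U₀) (A := A) (DA := fun y => covDivB η U₀ A y) (f := f) hL hη
    (⇑g) R gpar Eterm hα₄ hBG hBR (by positivity) ha₁' hb₁ hb₁' hcA hcA' hcDA hh₂ hl₂ (by positivity) (by positivity) hmf hθ hG
    (fun f f' => map_sub g f f') hRsub hRbd hg0 hg1 hgL hE0 hEL hDA hf hA h103 h106
  have e₁ : t₁ = s := huniq t₁ ⟨ht₁, hfix₁⟩
  have e₂ : t₂ = s := huniq t₂ ⟨ht₂, hfix₂⟩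
  rw [← hgp₁, ← hgp₂, e₁, e₂]

end Converse146B

end Literature.MathematicalPhysics.QuantumFieldTheory.Balaban1983to89.B8Prop5UniqKLevelBSrc

end
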